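/-
Copyright (c) 2026 The HCML crux team. All rights reserved.
Released under Apache 2.0 license as described in the file LICENSE.
Authors: K2E3-p14 (g5) (explicit-unit `hodgecm-mathlib-K2E3-p14-g5`)
-/
import Summits.HodgeConjecture.HodgeConjecture.Theorems.K2E3GL3TruncatedCharSplitTorusRadius   -- ★ (T18-split) this seat: `exists_adBall_mul_zpowDiagGL_of_adBall_conj`
import Mathlib.Topology.Algebra.Group.Quotient
import HarnessLib

/-!
# (GL-[M6]-sc, T18-split at `G_Λ`) The conjugating set of a split-regular class of `GL₃(F) ⧸ Λ₀·1` lies in a height ball times the torus lattice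

Cell `hodgecm-mathlib`, Track B, line `K2_E3_EllipticInputs`; payer «GL-[M6]-sc» of leaf (11-3-split-sc) ∕ (11-3-split-sc-NE) (dealer K2E3-plan (g3) D63, line
lead K2E3-p23 (g5), RULINGS #10 (M10-2) «RADIUS»).  Companion of ★ `K2E3GL3TruncatedCharSplitTorusRadius` (Harish-Chandra's Theorem 18 at the split Cartan of
`GL₃` with explicit exponent `6s + L`): the same statement read on `G_Λ = GL₃(F) ⧸ Λ₀·1` (any `Λ₀ ≤ F^×`) along an exhaustion `Ω` entering through its ★ B4-0
membership clause `hmem : mk g ∈ Ω m ↔ 𝔅_m(g)` (`exists_adHeightBall_compactExhaustion_quotScalar`, clause (i)), as the U(3) files do: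
* **`exists_mk_mul_zpowDiagGL_mem_of_conj_mem`** — `x̄ · mk t · x̄⁻¹ ∈ Ω s`, `x̄ = mk x`, `t = diag(d)` of depth `L` ⇒ `mk (x · diag(ϖ^{e})) ∈ Ω (6s + L)` for some `e`;
* **`mem_mul_image_range_zpowDiagGL_of_conj_mem`** — the support shape of Theorem 20's input: `x̄ · mk t · x̄⁻¹ ∈ Ω R₀ ⇒ x̄ ∈ Ω (6R₀ + L) · mk(ϖ^{ℤ³})`, so for
  `θ` with `tsupport θ ⊆ Ω R₀`: `θ(x̄ · mk t · x̄⁻¹) ≠ 0 ⇒ x̄ ∈ Ω(6R₀+L) · Ā_lattice` (`m_C = 6R₀ + L`; HC p. 71 eq. (1), (ii)).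

HONEST LABEL: HC_CM is proved only modulo the 7 printed citations (2 remaining named inputs: hLiu418 = stmt-HodgeConjecture-24832, h413 =
stmt-HodgeConjecture-24833) until rung 0 closes; count-neutral (kernel lane `--supports stmt-HodgeConjecture-24833 --as helper`), THEOREMS ONLY — no `def`, no
instance, no notation, no `sorry`.
References: Harish-Chandra (van Dijk), *Harmonic Analysis on Reductive p-adic Groups*, LNM 162 (1970), Part VII §2 Thm 18 + Cor. p. 69, §3 p. 71 eq. (1), (ii)
[cite: HarishChandra1970, Part VII §2 Theorem 18 p. 69].
-/

open Set Function
open scoped MatrixGroups Pointwise WithZero Topology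
open Matrix
open Literature.NumberTheory.Automorphic
open Summit.HodgeConjecture.HodgeConjecture.Cruxes.H413.K2E3GL3TruncatedCharSplitTorusRadius

set_option linter.dupNamespace false

noncomputable section

namespace Summit.HodgeConjecture.HodgeConjecture.Cruxes.H413.K2E3GL3ModCocompactSplitTorusRadius

/-! ## The conjugating set modulo the torus lattice, at `G_Λ = GL₃(F) ⧸ Λ₀·1` -/

section Quotient

variable {F : Type*} [Field F] [Valued F ℤᵐ⁰] (Λ₀ : Subgroup Fˣ) [(Λ₀.map (Matrix.GeneralLinearGroup.scalar (Fin 3))).Normal]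

/-- **THEOREM 18 AT `G_Λ`**: if the exhaustion `Ω` of `G_Λ` reads `mk g ∈ Ω m ↔ 𝔅_m(g)` (★ B4-0 `exists_adHeightBall_compactExhaustion_quotScalar`, clause (i)), `t = diag(d)`
with depth `L`, and `x̄ · mk t · x̄⁻¹ ∈ Ω s` for `x̄ = mk x`, then `mk (x · a) ∈ Ω (6s + L)` for some `a = diag(ϖ^{e})`. [cite: HarishChandra1970, Part VII §2 Theorem 18 p. 69;
§3 p. 71 (ii)] -/
theorem exists_mk_mul_zpowDiagGL_mem_of_conj_mem {ϖ : F} (hϖ : Valued.v ϖ = WithZero.exp (-1 : ℤ)) (hϖ0 : ϖ ≠ 0)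
    (Ω : CompactExhaustion (GL (Fin 3) F ⧸ Λ₀.map (Matrix.GeneralLinearGroup.scalar (Fin 3))))
    (hmem : ∀ (m : ℕ) (g : GL (Fin 3) F), (QuotientGroup.mk g : GL (Fin 3) F ⧸ Λ₀.map (Matrix.GeneralLinearGroup.scalar (Fin 3))) ∈ Ω m ↔
      ∀ i j k l, Valued.v (ϖ ^ m * ((g : Matrix (Fin 3) (Fin 3) F) i j * ((g⁻¹ : GL (Fin 3) F) : Matrix (Fin 3) (Fin 3) F) k l)) ≤ 1)
    {t x : GL (Fin 3) F} {d : Fin 3 → F} (ht : (t : Matrix (Fin 3) (Fin 3) F) = Matrix.diagonal d) {s L : ℕ}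
    (hD : Valued.v (ϖ ^ L * (d 0 * d 1 * d 2) ^ 2) ≤ Valued.v (((d 0 - d 1) * (d 0 - d 2) * (d 1 - d 2)) ^ 2))
    (hg : (QuotientGroup.mk x : GL (Fin 3) F ⧸ Λ₀.map (Matrix.GeneralLinearGroup.scalar (Fin 3))) * QuotientGroup.mk t * (QuotientGroup.mk x)⁻¹ ∈ Ω s) :
    ∃ e : Fin 3 → ℤ, (QuotientGroup.mk (x * zpowDiagGL (n := 3) hϖ0 e) : GL (Fin 3) F ⧸ Λ₀.map (Matrix.GeneralLinearGroup.scalar (Fin 3))) ∈ Ω (6 * s + L) := by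
  rw [← QuotientGroup.mk_inv, ← QuotientGroup.mk_mul, ← QuotientGroup.mk_mul, hmem] at hg
  obtain ⟨e, he⟩ := exists_adBall_mul_zpowDiagGL_of_adBall_conj hϖ hϖ0 ht hg hD
  exact ⟨e, (hmem _ _).2 he⟩

/-- **THE SUPPORT SHAPE** (input `hsupp`∕`m_C` of Theorem 20 at `GL₃`): with `Ω` as above and `t = diag(d)` of depth `L`, every `x̄ ∈ G_Λ` with
`x̄ · mk t · x̄⁻¹ ∈ Ω R₀` lies in `Ω (6R₀ + L) · mk(ϖ^{ℤ³})` — so for `θ` with `tsupport θ ⊆ Ω R₀`, `θ(x̄ · mk t · x̄⁻¹) ≠ 0 ⇒ x̄ ∈ Ω(6R₀+L) · Ā_lattice`.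
[cite: HarishChandra1970, Part VII §2 Theorem 18 p. 69; §3 p. 71 eq. (1), (ii)] -/
theorem mem_mul_image_range_zpowDiagGL_of_conj_mem {ϖ : F} (hϖ : Valued.v ϖ = WithZero.exp (-1 : ℤ)) (hϖ0 : ϖ ≠ 0)
    (Ω : CompactExhaustion (GL (Fin 3) F ⧸ Λ₀.map (Matrix.GeneralLinearGroup.scalar (Fin 3))))
    (hmem : ∀ (m : ℕ) (g : GL (Fin 3) F), (QuotientGroup.mk g : GL (Fin 3) F ⧸ Λ₀.map (Matrix.GeneralLinearGroup.scalar (Fin 3))) ∈ Ω m ↔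
      ∀ i j k l, Valued.v (ϖ ^ m * ((g : Matrix (Fin 3) (Fin 3) F) i j * ((g⁻¹ : GL (Fin 3) F) : Matrix (Fin 3) (Fin 3) F) k l)) ≤ 1)
    {t : GL (Fin 3) F} {d : Fin 3 → F} (ht : (t : Matrix (Fin 3) (Fin 3) F) = Matrix.diagonal d) {R₀ L : ℕ}
    (hD : Valued.v (ϖ ^ L * (d 0 * d 1 * d 2) ^ 2) ≤ Valued.v (((d 0 - d 1) * (d 0 - d 2) * (d 1 - d 2)) ^ 2))
    (y : GL (Fin 3) F ⧸ Λ₀.map (Matrix.GeneralLinearGroup.scalar (Fin 3))) (hy : y * QuotientGroup.mk t * y⁻¹ ∈ Ω R₀) :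
    y ∈ (Ω (6 * R₀ + L) : Set (GL (Fin 3) F ⧸ Λ₀.map (Matrix.GeneralLinearGroup.scalar (Fin 3)))) *
      ((QuotientGroup.mk : GL (Fin 3) F → GL (Fin 3) F ⧸ Λ₀.map (Matrix.GeneralLinearGroup.scalar (Fin 3))) '' Set.range (zpowDiagGL (n := 3) hϖ0)) := by
  obtain ⟨x, rfl⟩ := QuotientGroup.mk_surjective y
  obtain ⟨e, he⟩ := exists_mk_mul_zpowDiagGL_mem_of_conj_mem Λ₀ hϖ hϖ0 Ω hmem ht hD hy
  have hx : (QuotientGroup.mk x : GL (Fin 3) F ⧸ Λ₀.map (Matrix.GeneralLinearGroup.scalar (Fin 3))) =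
      QuotientGroup.mk (x * zpowDiagGL (n := 3) hϖ0 e) * QuotientGroup.mk (zpowDiagGL (n := 3) hϖ0 (-e)) := by
    rw [← QuotientGroup.mk_mul, zpowDiagGL_neg, mul_inv_cancel_right]
  rw [hx]
  exact Set.mul_mem_mul he ⟨_, ⟨-e, rfl⟩, rfl⟩

end Quotient

end Summit.HodgeConjecture.HodgeConjecture.Cruxes.H413.K2E3GL3ModCocompactSplitTorusRadius

end
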